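import Literature.Computability.QuantumComplexity.CWrapLayout
import Literature.Computability.QuantumComplexity.RevMultiplex
import HarnessLib

/-!
# Zone gadgets and clean blocks at an offset; a clean block applied twice is the identity

Toolkit (trunk `CryptoQuantFine`) for classical reversible programs over `ℕ`-indexed wires
(`RevGadgets.ClOp`) that shuffle *zones* of wires and run garbage-free blocks
(`RevUncompute.cleanOps`) at offsets inside a larger register — the shape of Regev's per-register
routine (2004, proof of Lemma 3.12) in the tree's circuit model, written for the discharge of
`Literature.Algebra.EuclideanLattices.usvp_of_dihedralCoset`, but generic:

* gadgets: `swapZ a b len` (swap of the zones `[a, a+len)` and `[b, b+len)`, `RevMux.swapOps`),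
  `notsZ a len` (a run of `NOT`s), `copyZ src a len` (`CNOT`s from the wires `src j` onto a zone),
  with their semantics (`clEval_swapZ`/`swapFun`, `clEval_notsZ`, `clEval_copyZ`), well-formedness
  and wire bounds;
* **`clEval_cleanOps_twice`** — *a clean block applied to its own output restores its input*:
  on `d 0 … 0 readOut(l')` (the output of `cleanOps` on `d 0 … 0`) the block returns `d 0 … 0`
  (the suffix and compute halves act as before since they neither read nor write the result wires,
  the read-out `CNOT`s now cancel the result wires, and the uncompute half returns to `d`); so a
  second verbatim copy of a block undoes the first — no reversed block needs to be printed
  (Bennett 1973, §2; Nielsen–Chuang 2010, §3.2.5);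
* **`clEval_shift_cleanOps`**, `clEval_shift_cleanOps_twice`, `shift_cleanOps_lt`,
  `shift_cleanOps_wf` — a block placed at the offset `S` (`(cleanOps e M n₀ []).map (· + S)`):
  semantics by transport of `RevClean.clEval_cleanOps` along `i ↦ i + S`, wires, well-formedness.

## References

* C. H. Bennett, *Logical reversibility of computation*, IBM J. Res. Develop. 17 (1973), §2.
* M. A. Nielsen, I. L. Chuang, *Quantum Computation and Quantum Information*, CUP 2010, §1.3.4,
  §3.2.5.
* P. W. Shor, SIAM J. Comput. 26 (1997), §3 p. 8.
* O. Regev, *Quantum computation and lattice problems*, SIAM J. Comput. 33 (2004), proof of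
  Lemma 3.12 (p. 14).
-/

noncomputable section

namespace Literature.Computability.QuantumComplexity

namespace ZoneGadgets

open _root_.Computability Complexity Cryptography Turing RevSim RevClean RevMux

/-! ### Zone gadgets over `ℕ`-indexed wires -/

section Gadgets

/-- The pairs `(a + j, b + j)`, `j < len`. [folklore] -/
def zonePairs (a b len : ℕ) : List (ℕ × ℕ) := (List.range len).map fun j => (a + j, b + j)

/-- Membership in `zonePairs`. [folklore] -/
theorem mem_zonePairs {a b len : ℕ} {p : ℕ × ℕ} : p ∈ zonePairs a b len ↔ ∃ j < len, p = (a + j, b + j) := by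
  simp [zonePairs, eq_comm]

/-- **Swap of the zones `[a, a+len)` and `[b, b+len)`** (three `CNOT`s per pair). [cite: NielsenChuang2010, §1.3.4 (swap from three CNOTs)] -/
def swapZ (a b len : ℕ) : List (ClOp ℕ) := swapOps (zonePairs a b len)

/-- A run of `NOT` gates on `[a, a+len)`. [folklore] -/
def notsZ (a len : ℕ) : List (ClOp ℕ) := (List.range len).map fun j => ClOp.not (a + j)

/-- `CNOT`s from the wires `src j` onto the zone `[a, a+len)`. [folklore] -/
def copyZ (src : ℕ → ℕ) (a len : ℕ) : List (ClOp ℕ) := copyOps ((List.range len).map fun j => (src j, a + j))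

/-- The swap function of two disjoint zones on assignments. [folklore] -/
def swapFun (a b len : ℕ) (w : ℕ → Bool) : ℕ → Bool := fun i =>
  if a ≤ i ∧ i < a + len then w (i - a + b) else if b ≤ i ∧ i < b + len then w (i - b + a) else w i

/-- **Semantics of a zone swap** (disjoint zones). [folklore] -/
theorem clEval_swapZ {a b len : ℕ} (hab : a + len ≤ b ∨ b + len ≤ a) (w : ℕ → Bool) :
    clEval (swapZ a b len) w = swapFun a b len w := by
  have h1 : ((zonePairs a b len).map Prod.fst).Nodup := by
    simp only [zonePairs, List.map_map]
    exact (List.nodup_range.map_on fun i _ j _ h => by simpa using h)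
  have h2 : ((zonePairs a b len).map Prod.snd).Nodup := by
    simp only [zonePairs, List.map_map]
    exact (List.nodup_range.map_on fun i _ j _ h => by simpa using h)
  have h12 : ∀ p ∈ zonePairs a b len, ∀ q ∈ zonePairs a b len, p.1 ≠ q.2 := by
    intro p hp q hq
    obtain ⟨i, hi, rfl⟩ := mem_zonePairs.1 hp
    obtain ⟨j, hj, rfl⟩ := mem_zonePairs.1 hq
    simp only [ne_eq]; omega
  obtain ⟨hsnd, hfst, hoth⟩ := clEval_swapOps (zonePairs a b len) h1 h2 h12 w
  funext i
  unfold swapFun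
  by_cases ha : a ≤ i ∧ i < a + len
  · rw [if_pos ha]
    have := hfst (a + (i - a), b + (i - a)) (mem_zonePairs.2 ⟨i - a, by omega, rfl⟩)
    simp only at this
    rw [show a + (i - a) = i by omega] at this
    rw [swapZ, this]; congr 1; omega
  · rw [if_neg ha]
    by_cases hb : b ≤ i ∧ i < b + len
    · rw [if_pos hb]
      have := hsnd (a + (i - b), b + (i - b)) (mem_zonePairs.2 ⟨i - b, by omega, rfl⟩)
      simp only at this
      rw [show b + (i - b) = i by omega] at this
      rw [swapZ, this]; congr 1; omega
    · rw [if_neg hb, swapZ]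
      refine hoth i fun p hp => ?_
      obtain ⟨j, hj, rfl⟩ := mem_zonePairs.1 hp
      simp only; omega

/-- `swapZ` is well formed (disjoint zones). [folklore] -/
theorem swapZ_wf {a b len : ℕ} (hab : a + len ≤ b ∨ b + len ≤ a) : ∀ op ∈ swapZ a b len, op.WF :=
  swapOps_wf fun p hp => by obtain ⟨j, hj, rfl⟩ := mem_zonePairs.1 hp; simp only; omega

/-- Wires of `swapZ`. [folklore] -/
theorem swapZ_lt {a b len B : ℕ} (ha : a + len ≤ B) (hb : b + len ≤ B) : ∀ op ∈ swapZ a b len, ∀ i ∈ wiresOf op, i < B := by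
  intro op hop i hi
  obtain ⟨p, hp, rfl | rfl⟩ := mem_swapOps hop <;> obtain ⟨j, hj, rfl⟩ := mem_zonePairs.1 hp <;>
    simp [wiresOf, ClOp.target, ClOp.controls] at hi <;> omega

/-- **Semantics of a run of `NOT`s.** [folklore] -/
theorem clEval_notsZ (a len : ℕ) (w : ℕ → Bool) :
    clEval (notsZ a len) w = fun i => if a ≤ i ∧ i < a + len then !w i else w i := by
  have hnd : ((List.range len).map fun j => a + j).Nodup :=
    List.nodup_range.map_on fun i _ j _ h => by simpa using h
  have e : notsZ a len = ((List.range len).map fun j => a + j).map ClOp.not := by simp [notsZ, List.map_map]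
  funext i
  rw [e]
  by_cases hi : a ≤ i ∧ i < a + len
  · rw [if_pos hi]
    exact clEval_map_not_of_mem _ hnd w (List.mem_map.2 ⟨i - a, List.mem_range.2 (by omega), by omega⟩)
  · rw [if_neg hi, clEval_map_not_of_not_mem]
    intro hm
    obtain ⟨j, hj, hji⟩ := List.mem_map.1 hm
    rw [List.mem_range] at hj
    omega

/-- `notsZ` is well formed. [folklore] -/
theorem notsZ_wf (a len : ℕ) : ∀ op ∈ notsZ a len, op.WF := by
  intro op hop; simp only [notsZ, List.mem_map] at hop; obtain ⟨j, -, rfl⟩ := hop; trivial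

/-- Wires of `notsZ`. [folklore] -/
theorem notsZ_lt {a len B : ℕ} (ha : a + len ≤ B) : ∀ op ∈ notsZ a len, ∀ i ∈ wiresOf op, i < B := by
  intro op hop i hi
  simp only [notsZ, List.mem_map, List.mem_range] at hop
  obtain ⟨j, hj, rfl⟩ := hop
  simp [wiresOf, ClOp.target, ClOp.controls] at hi; omega

/-- **Semantics of a copy layer onto a zone** whose sources lie outside the zone: wire `a + j`
becomes `w (a + j) ⊕ w (src j)`, nothing else changes. [folklore] -/
theorem clEval_copyZ {src : ℕ → ℕ} {a len : ℕ} (hsrc : ∀ j < len, src j < a ∨ a + len ≤ src j) (w : ℕ → Bool) :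
    clEval (copyZ src a len) w = fun i => if a ≤ i ∧ i < a + len then w i ^^ w (src (i - a)) else w i := by
  set ps := (List.range len).map fun j => (src j, a + j) with hps
  have hnd : (ps.map Prod.snd).Nodup := by
    simp only [hps, List.map_map]
    exact List.nodup_range.map_on fun i _ j _ h => by simpa using h
  have hne : ∀ p ∈ ps, ∀ q ∈ ps, q.2 ≠ p.1 := by
    intro p hp q hq
    simp only [hps, List.mem_map, List.mem_range] at hp hq
    obtain ⟨i, hi, rfl⟩ := hp; obtain ⟨j, hj, rfl⟩ := hq
    have := hsrc i hi; simp only; omega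
  funext i
  by_cases hi : a ≤ i ∧ i < a + len
  · rw [if_pos hi]
    have hp : (src (i - a), a + (i - a)) ∈ ps := by
      simp only [hps, List.mem_map, List.mem_range]; exact ⟨i - a, by omega, rfl⟩
    have := clEval_copyOps_target ps hnd hne w hp
    simp only at this
    rw [show a + (i - a) = i by omega] at this
    rw [copyZ, this]
  · rw [if_neg hi, copyZ]
    refine clEval_copyOps_of_ne ps w fun p hp => ?_
    simp only [hps, List.mem_map, List.mem_range] at hp
    obtain ⟨j, hj, rfl⟩ := hp; simp only; omega

/-- `copyZ` is well formed (sources outside the zone). [folklore] -/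
theorem copyZ_wf {src : ℕ → ℕ} {a len : ℕ} (hsrc : ∀ j < len, src j < a ∨ a + len ≤ src j) :
    ∀ op ∈ copyZ src a len, op.WF :=
  copyOps_wf fun p hp => by
    simp only [List.mem_map, List.mem_range] at hp
    obtain ⟨j, hj, rfl⟩ := hp; have := hsrc j hj; simp only; omega

/-- Wires of `copyZ`. [folklore] -/
theorem copyZ_lt {src : ℕ → ℕ} {a len B : ℕ} (ha : a + len ≤ B) (hsrc : ∀ j < len, src j < B) :
    ∀ op ∈ copyZ src a len, ∀ i ∈ wiresOf op, i < B := by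
  intro op hop i hi
  rw [copyZ, mem_copyOps] at hop
  obtain ⟨p, hp, rfl⟩ := hop
  simp only [List.mem_map, List.mem_range] at hp
  obtain ⟨j, hj, rfl⟩ := hp
  simp [wiresOf, ClOp.target, ClOp.controls] at hi
  rcases hi with rfl | rfl
  · omega
  · exact hsrc j hj

end Gadgets

/-! ### A clean block applied twice; blocks at an offset -/

section Blocks

variable {e : ℕ} {M : TM2ComputableAux Bool Bool}

/-- Running the suffix gadget on `strW (d ++ v)` clears `v` again. [folklore] -/
theorem clEval_notsV_strW_append (d v : List Bool) : clEval (notsV d.length v) (strW (d ++ v)) = strW d := by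
  have h := clEval_notsV_strW (v := v) d
  have hinv : clEval (notsV d.length v) (clEval (notsV d.length v) (strW d)) = strW d := by
    funext i
    rw [clEval_notsV_apply, clEval_notsV_apply]
    cases (decide (d.length ≤ i ∧ i < d.length + v.length) && v.getD (i - d.length) false) <;> simp
  rw [h] at hinv
  exact hinv

/-- **A clean block applied to its own output restores its input.** If `M` on `d ++ v` outputs
`l'` within `T(n)`, then `cleanOps` maps `d 0…0 readOut(l')` (the output of the block on
`d 0…0`) back to `d 0…0`: the suffix and compute halves act as before (they neither read nor
write the result wires), the read-out `CNOT`s now cancel the result wires, and the uncompute half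
returns to `d v`, cleared to `d`. Hence a second copy of the block undoes the first.
[cite: NielsenChuang2010, §3.2.5 (uncomputation)] -/
theorem clEval_cleanOps_twice (d v l' : List Bool)
    (hM : M.OutputsWithin (d ++ v) l' (Tn e (d.length + v.length))) :
    clEval (cleanOps e M d.length v) (clEval (cleanOps e M d.length v) (strW d)) = strW d := by
  set n := d.length + v.length with hn_def
  set u := d ++ v with hu
  have hn : u.length = n := by simp [hu, hn_def]
  set σ₁ := clEval (cleanOps e M d.length v) (strW d) with hσ₁
  have hσ₁eq : clEval (cleanOps e M d.length v) (strW d) =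
      fun i => if i < d.length then d.getD i false else readOut e M n l' i := clEval_cleanOps (e := e) (M := M) d v l' hM
  -- the state after the first compute half, and its properties (as in `clEval_cleanOps`)
  set x : Fin n → Bool := xOf u n with hx
  have hsteps : clEval (comp e M n) (strW u) = wAt (e := e) (M := M) n x (Tn e n) := by
    rw [← W₀_xOf hn]; exact clEval_steps n x (Tn e n)
  have hM' : M.OutputsWithin (List.ofFn x) l' (Tn e n) := by rwa [hx, ofFn_xOf hn]
  have hinv : Inv e n (Tn e n) (cfgAt M n x (Tn e n)) (wAt (e := e) (M := M) n x (Tn e n)) := inv_wAt n x _ le_rfl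
  have hcfg : cfgAt M n x (Tn e n) = haltList M.tm (l'.map M.outputAlphabet.symm) :=
    TM2Sim.iterate_stepTotal_of_outputsWithin M hM'
  set w2 := wAt (e := e) (M := M) n x (Tn e n) with hw2
  have h2c : ∀ i, NN e M n ≤ i → w2 i = false := fun i hi =>
    hinv.fresh i ((RB_le_ansW le_rfl).trans (Nat.le_of_succ_le (by rwa [NN_eq] at hi)))
  have h2b : ∀ j < JJ e M n, ∀ a : OSym M, w2 (cellW M.tm e n (Tn e n) j ⟨M.tm.k₁, a⟩) = outBit M l' j a := by
    intro j hj a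
    have := hinv.cell j hj ⟨M.tm.k₁, a⟩
    rw [hcfg] at this
    rw [this, outBit]
  -- (1) the suffix gadget on `σ₁`: `strW u` overlaid with the read-out
  set τ : ℕ → Bool := fun i => if NN e M n ≤ i then readOut e M n l' i else strW u i with hτ
  have hstep1 : clEval (notsV d.length v) σ₁ = τ := by
    funext i
    rw [clEval_notsV_apply, hσ₁, hσ₁eq]
    simp only [hτ]
    by_cases h1 : NN e M n ≤ i
    · have hi1 : ¬ i < d.length := by have := le_NN (e := e) (M := M) n; omega
      have hi2 : ¬ (d.length ≤ i ∧ i < d.length + v.length) := by have := le_NN (e := e) (M := M) n; omega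
      simp [hi1, hi2, h1]
    · rw [if_neg h1]
      by_cases hi : i < d.length
      · have hi2 : ¬ (d.length ≤ i ∧ i < d.length + v.length) := by omega
        simp only [hi, if_true, hi2, decide_false, Bool.false_and, Bool.xor_false, strW, hu]
        exact (List.getD_append _ _ _ _ hi).symm
      · rw [if_neg hi]
        by_cases hiv : i < d.length + v.length
        · have hr : readOut e M n l' i = false := by rw [readOut, if_neg (fun h => h1 h.1)]
          simp only [not_lt.1 hi, hiv, and_self, decide_true, Bool.true_and, strW, hu]
          rw [hr, Bool.false_xor, List.getD_append_right _ _ _ _ (not_lt.1 hi)]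
        · have hr : readOut e M n l' i = false := by rw [readOut, if_neg (fun h => h1 h.1)]
          simp only [hiv, and_false, decide_false, Bool.false_and, Bool.xor_false, strW, hu]
          rw [hr, List.getD_eq_default]
          simp only [List.length_append]; omega
  -- (2) the compute half on `τ`: frame rule for the result wires
  have hstep2 : clEval (comp e M n) τ = fun i => if NN e M n ≤ i then readOut e M n l' i else w2 i := by
    have hfr := clEval_ite (fun i => NN e M n ≤ i) (comp e M n) (fun op hop => ?_) (readOut e M n l') (strW u)
    · have e1 : (fun i => if NN e M n ≤ i then readOut e M n l' i else strW u i) = τ := rfl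
      rw [e1] at hfr
      rw [hfr, hsteps]
    · constructor
      · have := comp_lt op hop op.target (by simp [wiresOf]); exact not_le.2 this
      · intro c hc; have := comp_lt op hop c (by simp [wiresOf, hc]); exact not_le.2 this
  -- (3) the read-out cancels
  have hstep3 : clEval (outOps e M n) (fun i => if NN e M n ≤ i then readOut e M n l' i else w2 i) = w2 := by
    set w2' : ℕ → Bool := fun i => if NN e M n ≤ i then readOut e M n l' i else w2 i with hw2'
    funext i
    by_cases hres : ∃ p ∈ outPairs e M n, p.2 = i
    · obtain ⟨p, hp, rfl⟩ := hres
      obtain ⟨j, hj, a, rfl⟩ := mem_outPairs.1 hp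
      have := clEval_copyOps_target (outPairs e M n) (nodup_outPairs_snd n) outPairs_target_ne_source w2' hp
      simp only at this
      rw [outOps, this]
      simp only [hw2']
      rw [if_pos (NN_le_resW n j a), readOut_resW hj, if_neg (not_le.2 (cellW_T_lt_NN hj a)), h2b j hj a,
        Bool.xor_self, h2c _ (NN_le_resW n j a)]
    · push Not at hres
      rw [outOps, clEval_copyOps_of_ne _ _ (fun p hp => hres p hp)]
      simp only [hw2']
      by_cases h1 : NN e M n ≤ i
      · rw [if_pos h1, h2c i h1, readOut]
        by_cases h2 : i < NN e M n + copyN e M n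
        · obtain ⟨j, hj, a, rfl⟩ := exists_resW_eq h1 h2
          exact absurd rfl (hres _ (mem_outPairs.2 ⟨j, hj, a, rfl⟩))
        · rw [if_neg (fun h => h2 h.2)]
      · rw [if_neg h1]
  -- (4) uncompute and clear
  have ecl : cleanOps e M d.length v = notsV d.length v ++ (comp e M n ++ (outOps e M n ++ ((comp e M n).reverse ++ notsV d.length v))) := rfl
  rw [ecl, clEval_append, hstep1, clEval_append, hstep2, clEval_append, hstep3, clEval_append, ← hsteps,
    clEval_reverse_clEval _ comp_wf, hu, clEval_notsV_strW_append]

/-- The assignment of a window: `d` on `[S, S + |d|)`, read-out as given, zero elsewhere in the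
window, arbitrary outside. We phrase block semantics at an offset through the pulled-back
assignment `w ∘ (· + S)`. [folklore] -/
theorem comp_add_strW {S : ℕ} {w : ℕ → Bool} {d : List Bool} (hw : ∀ i, w (S + i) = strW d i) :
    (w ∘ fun i => i + S) = strW d := by
  funext i; simp only [Function.comp_apply]; rw [Nat.add_comm]; exact hw i

/-- **Semantics of a clean block at the offset `S`** (empty suffix): if the window
`[S, S + width)` holds `d 0 … 0` then afterwards it holds `d 0…0 readOut(fd)`, and no wire outside
the window changes. [cite: Shor1997, §3 p.8 (compute F(x) keeping x, copy, undo)] -/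
theorem clEval_shift_cleanOps {S : ℕ} (d l' : List Bool) (hM : M.OutputsWithin d l' (Tn e d.length))
    (w : ℕ → Bool) (hw : ∀ i, w (S + i) = strW d i) :
    clEval ((cleanOps e M d.length []).map (ClOp.map (· + S))) w =
      fun i => if S ≤ i then (if i - S < d.length then d.getD (i - S) false else readOut e M d.length l' (i - S)) else w i := by
  have hinj : Function.Injective (fun i : ℕ => i + S) := fun a b h => by simpa using h
  have hsem := clEval_cleanOps (e := e) (M := M) d [] l' (by simpa using hM)
  simp only [List.length_nil, Nat.add_zero] at hsem
  funext i
  by_cases hi : S ≤ i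
  · rw [if_pos hi]
    have := clEval_map_apply hinj (cleanOps e M d.length []) w (i - S)
    rw [show i - S + S = i by omega] at this
    rw [this, comp_add_strW hw, hsem]
  · rw [if_neg hi]
    exact clEval_map_apply_of_not_mem_range _ _ _ (by rintro ⟨j, rfl⟩; simp at hi)

/-- **The second copy of a shifted block undoes the first.** [cite: NielsenChuang2010, §3.2.5 (uncomputation)] -/
theorem clEval_shift_cleanOps_twice {S : ℕ} (d l' : List Bool) (hM : M.OutputsWithin d l' (Tn e d.length))
    (w : ℕ → Bool) (hw : ∀ i, w (S + i) = strW d i) :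
    clEval ((cleanOps e M d.length []).map (ClOp.map (· + S)))
      (clEval ((cleanOps e M d.length []).map (ClOp.map (· + S))) w) = w := by
  have hinj : Function.Injective (fun i : ℕ => i + S) := fun a b h => by simpa using h
  have htw := clEval_cleanOps_twice (e := e) (M := M) d [] l' (by simpa using hM)
  funext i
  by_cases hi : S ≤ i
  · have e1 := clEval_map_apply hinj (cleanOps e M d.length [])
      (clEval ((cleanOps e M d.length []).map (ClOp.map (· + S))) w) (i - S)
    rw [show i - S + S = i by omega] at e1
    rw [e1, clEval_map_comp hinj, comp_add_strW hw, htw, ← comp_add_strW hw]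
    simp only [Function.comp_apply]; congr 1; omega
  · have hni : i ∉ Set.range (fun j : ℕ => j + S) := by rintro ⟨j, rfl⟩; simp at hi
    rw [clEval_map_apply_of_not_mem_range _ _ _ hni, clEval_map_apply_of_not_mem_range _ _ _ hni]

-- (local forms follow the wire bounds below)

/-- Wires of a shifted block. [folklore] -/
theorem shift_cleanOps_lt {n₀ S B : ℕ} (hB : S + RevClean.width e M n₀ ≤ B) :
    ∀ op ∈ (cleanOps e M n₀ []).map (ClOp.map (· + S)), ∀ i ∈ wiresOf op, i < B := by
  intro op hop i hi
  obtain ⟨op', hop', rfl⟩ := List.mem_map.1 hop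
  have hlt := cleanOps_lt (e := e) (M := M) (n₀ := n₀) (v := []) op' hop'
  simp only [List.length_nil, Nat.add_zero] at hlt
  simp only [mem_wiresOf, ClOp.target_map, ClOp.controls_map, List.mem_map] at hi
  rcases hi with rfl | ⟨c, hc, rfl⟩
  · have := hlt op'.target (by simp [wiresOf]); omega
  · have := hlt c (by simp [wiresOf, hc]); omega

/-- A shifted block is well formed. [folklore] -/
theorem shift_cleanOps_wf (n₀ S : ℕ) : ∀ op ∈ (cleanOps e M n₀ []).map (ClOp.map (· + S)), op.WF := by
  intro op hop
  obtain ⟨op', hop', rfl⟩ := List.mem_map.1 hop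
  exact (cleanOps_wf op' hop').map fun a b h => by simpa using h


/-- **Semantics of a clean block at the offset `S`, local form.** If the window `[S, S + width)`
holds `d 0 … 0` (nothing is assumed outside the window), then afterwards the window holds
`d 0 … 0 readOut(l')` and no wire outside the window changes.
[cite: Shor1997, §3 p.8 (compute F(x) keeping x, copy, undo)] -/
theorem clEval_shift_cleanOps_local {S : ℕ} (d l' : List Bool) (hM : M.OutputsWithin d l' (Tn e d.length))
    (w : ℕ → Bool) (hw : ∀ i < RevClean.width e M d.length, w (S + i) = strW d i) :
    clEval ((cleanOps e M d.length []).map (ClOp.map (· + S))) w =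
      fun i => if S ≤ i ∧ i < S + RevClean.width e M d.length then
        (if i - S < d.length then d.getD (i - S) false else readOut e M d.length l' (i - S)) else w i := by
  -- a global extension of the window content
  set w' : ℕ → Bool := fun i => if S ≤ i then strW d (i - S) else false with hw'
  have hw'S : ∀ i, w' (S + i) = strW d i := fun i => by simp [hw']
  have hglob := clEval_shift_cleanOps (e := e) (M := M) (S := S) d l' hM w' hw'S
  have hops := shift_cleanOps_lt (e := e) (M := M) (n₀ := d.length) (S := S) (B := S + RevClean.width e M d.length) le_rfl
  have hagree := clEval_agree (fun i => S ≤ i ∧ i < S + RevClean.width e M d.length)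
    ((cleanOps e M d.length []).map (ClOp.map (· + S))) (fun op hop i hi => ?_) (w := w) (w' := w') (fun i hi => ?_)
  · funext i
    by_cases hi : S ≤ i ∧ i < S + RevClean.width e M d.length
    · rw [if_pos hi, hagree i hi, hglob]
      dsimp only
      rw [if_pos hi.1]
    · rw [if_neg hi]
      refine clEval_apply_of_forall_target_ne _ _ fun op hop heq => hi ?_
      rw [← heq]
      constructor
      · obtain ⟨op', -, rfl⟩ := List.mem_map.1 hop
        rw [ClOp.target_map]; exact Nat.le_add_left _ _
      · exact hops op hop _ (by simp [wiresOf])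
  · refine ⟨?_, hops op hop i hi⟩
    obtain ⟨op', -, rfl⟩ := List.mem_map.1 hop
    simp only [mem_wiresOf, ClOp.target_map, ClOp.controls_map, List.mem_map] at hi
    rcases hi with rfl | ⟨c, -, rfl⟩ <;> exact Nat.le_add_left _ _
  · obtain ⟨h1, h2⟩ := hi
    simp only [hw', h1, if_true]
    rw [← hw (i - S) (by omega), show S + (i - S) = i by omega]

/-- **The second copy of a shifted block undoes the first, local form.** [cite: NielsenChuang2010, §3.2.5 (uncomputation)] -/
theorem clEval_shift_cleanOps_twice_local {S : ℕ} (d l' : List Bool) (hM : M.OutputsWithin d l' (Tn e d.length))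
    (w : ℕ → Bool) (hw : ∀ i < RevClean.width e M d.length, w (S + i) = strW d i) :
    clEval ((cleanOps e M d.length []).map (ClOp.map (· + S)))
      (clEval ((cleanOps e M d.length []).map (ClOp.map (· + S))) w) = w := by
  set ops := (cleanOps e M d.length []).map (ClOp.map (· + S)) with hops_def
  set w' : ℕ → Bool := fun i => if S ≤ i then strW d (i - S) else false with hw'
  have hw'S : ∀ i, w' (S + i) = strW d i := fun i => by simp [hw']
  have hglob := clEval_shift_cleanOps_twice (e := e) (M := M) (S := S) d l' hM w' hw'S
  have hops := shift_cleanOps_lt (e := e) (M := M) (n₀ := d.length) (S := S) (B := S + RevClean.width e M d.length) le_rfl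
  have hP : ∀ op ∈ ops, ∀ i ∈ wiresOf op, S ≤ i ∧ i < S + RevClean.width e M d.length := by
    intro op hop i hi
    refine ⟨?_, hops op hop i hi⟩
    obtain ⟨op', -, rfl⟩ := List.mem_map.1 hop
    simp only [mem_wiresOf, ClOp.target_map, ClOp.controls_map, List.mem_map] at hi
    rcases hi with rfl | ⟨c, -, rfl⟩ <;> exact Nat.le_add_left _ _
  have hag1 := clEval_agree _ ops hP (w := w) (w' := w') (fun i hi => by
    obtain ⟨h1, h2⟩ := hi
    simp only [hw', h1, if_true]
    rw [← hw (i - S) (by omega), show S + (i - S) = i by omega])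
  have hag2 := clEval_agree _ ops hP (w := clEval ops w) (w' := clEval ops w') hag1
  funext i
  by_cases hi : S ≤ i ∧ i < S + RevClean.width e M d.length
  · rw [hag2 i hi, hglob]
    simp only [hw', hi.1, if_true]
    rw [← hw (i - S) (by omega), show S + (i - S) = i by omega]
  · have hnt : ∀ op ∈ ops, op.target ≠ i := fun op hop heq => hi (heq ▸ hP op hop _ (by simp [wiresOf]))
    rw [clEval_apply_of_forall_target_ne _ _ (fun op hop heq => hnt op hop heq),
      clEval_apply_of_forall_target_ne _ _ (fun op hop heq => hnt op hop heq)]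

end Blocks

end ZoneGadgets

end Literature.Computability.QuantumComplexity

end
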